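import Literature.Computability.Cryptography.ShorAssemblyLeavesProofs
import Literature.Computability.Cryptography.ShorProofs
import Literature.Computability.Cryptography.QuantumCircuitProofs
import Literature.Computability.Cryptography.QubitRegisterCliffordTProofs
import Literature.Computability.Complexity.OracleComposition
import Literature.Computability.Complexity.ValiantVaziraniReduction
import Literature.Computability.Complexity.CoinBlockRejectionSampling
import HarnessLib

/-!
# `RP^{BQP} ⊆ BQP`: one-sided-error polynomial time with a `BQP` oracle is quantum polynomial time

Topic `Literature/Computability/QuantumComplexity`. Reproduction (statement and proof assembled from
the tree's discharged subroutine theorem) of the classical closure of `BQP` under randomized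
polynomial-time Turing reductions with one-sided error:

* **`rp_PRel_subset_BQP`** `: A ∈ BQP → rp (PRel (Oracle.ofLanguage A)) ⊆ BQP` — if `L` is decided with
  one-sided error `1/2` by a polynomial-time oracle machine with oracle `A ∈ BQP` and uniformly random
  coins (`rp (P^A)`, the tree's `rp` operator over `PRel`), then `L ∈ BQP`;
* **`rp_PRelClass_BQP_subset_BQP`** `: rp (PRelClass BQP) ⊆ BQP` (`RP^{BQP} ⊆ BQP`), and the special
  cases `PRel_subset_BQP_of_mem_BQP : A ∈ BQP → P^A ⊆ BQP`, `PRelClass_BQP_subset_BQP : P^{BQP} ⊆ BQP`.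

Sources. Bennett–Bernstein–Brassard–Vazirani 1997, Thm. 4.14 (a `BQP` machine may call `BQP`
subroutines: `BQP^{BQP} = BQP`) and Cor. 4.15; Bernstein–Vazirani 1997, Thm. 8.3 (`BPP ⊆ BQP`: coins
are Hadamard-measured qubits). The tree already holds the CLASSICAL-CALLER form of Thm. 4.14 as a
proved principle, `Cryptography.isQSolvable_of_mem_FPRel_BQP_holds` (`ShorAssemblyLeavesProofs.lean`):
for `A ∈ BQP`, `G ∈ FP^A` and a coin polynomial `q`, if for every `x` the coin strings `c ∈ {0,1}^{q|x|}`
with `G ⟨x, c⟩ ∈ R x` have probability `≥ 3/4` (for an extension-closed relation `R`), then `R` is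
solvable by a uniform oracle-free Clifford+`T` family with probability `≥ 2/3` (`IsQSolvable R`); and
`Cryptography.mem_BQP_of_isQSolvable_bit` turns a solved one-bit relation `{z | [x ∈ L] <+: z}` into
`L ∈ BQP`. What is assembled here: (1) error reduction `1/2 ↦ 3/4` of the `rp` witness by the
two-block disjunction `CoinBlocks.blockOr L' p 2` (`uniformProb_blockOr_ge_of_le`: `k` blocks lift a
per-block acceptance probability `≥ a` to `≥ 1 - (1 - a)^k`; the tree's `uniformProb_blockOr_ge_half` is
the case `a = 1/(r+1)`), which stays in `P^A` (`ValiantVazirani.blockOr_mem_PRel`) and rejects every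
coin string when no block accepts (`CoinBlocks.boolPair_not_mem_blockOr`); (2) the indicator of a `P^A`
language is an `FP^A` function (`OracleAlg.ofLanguage_mem_FPRel_of_mem_PRel`), so `G := [· ∈ L'']`
writes the bit `[x ∈ L]` with probability `≥ 3/4` on members (amplified acceptance) and with
probability `1` on non-members (one-sided error: no coin string accepts); (3) the two named principles.
Everything is proved; trust base = the tree's (Mathlib axioms only).

NOT here: two-sided error (`BPP^{BQP} ⊆ BQP` needs majority amplification of the caller, same method),
quantum callers (`BQP^{BQP} = BQP`, Thm. 4.14 proper, needs the tidy-subroutine uncomputation).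

## References

* C. H. Bennett, E. Bernstein, G. Brassard, U. Vazirani, *Strengths and weaknesses of quantum
  computing*, SIAM J. Comput. 26(5) (1997) 1510–1523, Thm. 4.14, Cor. 4.15
  [BennettBernsteinBrassardVazirani1997].
* E. Bernstein, U. Vazirani, *Quantum complexity theory*, SIAM J. Comput. 26(5) (1997) 1411–1473,
  §8, Thm. 8.3 [BernsteinVazirani1997].
* S. Arora, B. Barak, *Computational Complexity: A Modern Approach*, CUP 2009, §7.4.1 (error
  reduction for one-sided error), §10.3 [AroraBarak2009].
-/

noncomputable section

namespace Literature.Computability.QuantumComplexity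

open _root_.Computability Complexity Cryptography Polynomial

namespace RPRelBQP

/-! ### Error reduction for one-sided error by block disjunction, general form -/

/-- **`k`-block disjunction lifts acceptance `≥ a` per block to `≥ 1 - (1 - a)^k`** (`k = r(|x|) + 1`
blocks of length `p(|x|)`). [Arora–Barak 2009, §7.4.1] [cite: AroraBarak2009, §7.4.1] -/
theorem uniformProb_blockOr_ge_of_le {A : Language Bool} {p r : Polynomial ℕ} {x : List Bool} {a : ℝ}
    (_ha : a ≤ 1) (h : a ≤ uniformProb (p.eval x.length) {z | boolPair x z ∈ A}) :
    1 - (1 - a) ^ (r.eval x.length + 1) ≤ uniformProb ((r.eval x.length + 1) * p.eval x.length)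
      {y | boolPair x y ∈ CoinBlocks.blockOr A p (r + 1)} := by
  set ℓ := p.eval x.length with hℓ
  set K := r.eval x.length + 1 with hK
  set G : Set (List Bool) := {z | boolPair x z ∈ A} with hG
  set E : Set (List Bool) := {y | boolPair x y ∈ CoinBlocks.blockOr A p (r + 1)} with hE
  have hcompl : Eᶜ = CoinBlocks.allBlocks ℓ K Gᶜ := by
    rw [hE, CoinBlocks.compl_setOf_mem_blockOr]
    rfl
  have hcnt : cnt (K * ℓ) Eᶜ = cnt ℓ Gᶜ ^ K := by
    rw [hcompl, CoinBlocks.cnt_allBlocks_eq_pow]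
  have hbad : uniformProb (K * ℓ) Eᶜ = (uniformProb ℓ Gᶜ) ^ K := by
    rw [uniformProb_eq_cnt_div, uniformProb_eq_cnt_div, hcnt, div_pow, ← pow_mul, mul_comm ℓ K]
    push_cast
    rfl
  have hGc : uniformProb ℓ Gᶜ = 1 - uniformProb ℓ G := Complexity.uniformProb_compl ℓ G
  have hpow : (uniformProb ℓ Gᶜ) ^ K ≤ (1 - a) ^ K := by
    rw [hGc]
    exact pow_le_pow_left₀ (by linarith [uniformProb_le_one ℓ G]) (by linarith) K
  have hEc : uniformProb (K * ℓ) E = 1 - uniformProb (K * ℓ) Eᶜ := by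
    rw [Complexity.uniformProb_compl]; ring
  rw [hEc, hbad]
  linarith

/-! ### The closure -/

/-- **`rp (P^A) ⊆ BQP` for `A ∈ BQP`** (one-sided-error classical polynomial time with a `BQP` oracle).
[cite: BennettBernsteinBrassardVazirani1997, Thm. 4.14 and Cor. 4.15; BernsteinVazirani1997, Thm. 8.3] -/
theorem rp_PRel_subset_BQP {A : Language Bool} (hA : A ∈ BQP) : rp (PRel (Oracle.ofLanguage A)) ⊆ BQP := by
  intro L hL
  obtain ⟨L', hL', p, hp⟩ := hL
  -- the two-block amplification of the witness language, still in `P^A`, and its indicator in `FP^A`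
  have hL'' : CoinBlocks.blockOr L' p (1 + 1) ∈ PRel (Oracle.ofLanguage A) :=
    ValiantVazirani.blockOr_mem_PRel hL' p (1 + 1) fun a b => by simp
  have hG : Oracle.ofLanguage (CoinBlocks.blockOr L' p (1 + 1)) ∈ FPRel (Oracle.ofLanguage A) :=
    OracleAlg.ofLanguage_mem_FPRel_of_mem_PRel hL''
  have hbit : ∀ (M : Language Bool) (y : List Bool), M.boolIndicator y = true ↔ y ∈ M :=
    fun M y => (Set.mem_iff_boolIndicator _ _).symm
  -- the one-bit relation `[x ∈ L] <+: z`
  have hR : ∀ x, ∀ y ∈ (fun x => {z : List Bool | [L.boolIndicator x] <+: z}) x, ∀ z, y <+: z →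
      z ∈ (fun x => {z : List Bool | [L.boolIndicator x] <+: z}) x :=
    fun x y hy z hyz => List.IsPrefix.trans hy hyz
  have hmem : ∀ x c, Oracle.ofLanguage (CoinBlocks.blockOr L' p (1 + 1)) (boolPair x c) ∈
      (fun x => {z : List Bool | [L.boolIndicator x] <+: z}) x ↔
        (boolPair x c ∈ CoinBlocks.blockOr L' p (1 + 1) ↔ x ∈ L) := by
    intro x c
    show [L.boolIndicator x] <+: [(CoinBlocks.blockOr L' p (1 + 1)).boolIndicator (boolPair x c)] ↔ _
    have hpre : ∀ a b : Bool, [a] <+: [b] ↔ a = b := fun a b =>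
      ⟨fun ⟨t, ht⟩ => by simpa using congrArg List.head? ht, fun h => h ▸ List.prefix_rfl⟩
    rw [hpre, Bool.eq_iff_iff, hbit, hbit]
    exact Iff.comm
  have hn : ∀ x : List Bool, (p + p).eval x.length = (1 + 1) * p.eval x.length := fun x => by
    rw [eval_add]; ring
  have hsolv : IsQSolvable fun x => {z : List Bool | [L.boolIndicator x] <+: z} := by
    refine isQSolvable_of_mem_FPRel_BQP_holds A _ (p + p) _ hR hA hG fun x => ?_
    rw [hn]
    by_cases hx : x ∈ L
    · have hamp := uniformProb_blockOr_ge_of_le (r := 1) (by norm_num : (1 / 2 : ℝ) ≤ 1) ((hp x).1 hx)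
      rw [eval_one] at hamp
      refine le_trans (by norm_num) (hamp.trans (Cryptography.uniformProb_mono _ fun c hc => ?_))
      exact (hmem x c).2 (iff_of_true hc hx)
    · refine le_trans (by norm_num : (3 / 4 : ℝ) ≤ 1) ((Complexity.uniformProb_univ _).symm.le.trans
        (BlockRejection.uniformProb_mono_len fun c hc _ => ?_))
      refine (hmem x c).2 (iff_of_false ?_ hx)
      exact CoinBlocks.boolPair_not_mem_blockOr (fun z hz => (hp x).2 hx z hz) (by rw [hc, eval_one])
  exact mem_BQP_of_isQSolvable_bit (fun _ _ => QCircuit.outputPMF_apply_holds) cliffordT_isUnitary_holds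
    (hbit L) hsolv

/-- `P^O ⊆ rp (P^O)`: a deterministic oracle machine is a coin-free one-sided-error machine (witness
language `fstF⁻¹' L`, zero coins). [Arora–Barak 2009, §7.3] [folklore] -/
theorem mem_rp_PRel_of_mem {O : Oracle} {L : Language Bool} (hL : L ∈ PRel O) : L ∈ rp (PRel O) := by
  refine ⟨Brick.fstF ⁻¹' L, preimage_mem_PRel hL Brick.fstF_mem_FP, 0, fun x => ⟨fun hx => ?_, fun hx y _ hy => ?_⟩⟩
  · rw [eval_zero]
    refine le_trans (by norm_num : (1 / 2 : ℝ) ≤ 1) ((Complexity.uniformProb_univ 0).symm.le.trans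
      (BlockRejection.uniformProb_mono_len fun y _ _ => ?_))
    simp only [Set.mem_setOf_eq]
    rw [memL_preimage, Brick.fstF_boolPair]
    exact hx
  · rw [memL_preimage, Brick.fstF_boolPair] at hy
    exact hx hy

/-- **`P^A ⊆ BQP` for `A ∈ BQP`.** [cite: BennettBernsteinBrassardVazirani1997, Cor. 4.15] -/
theorem PRel_subset_BQP_of_mem_BQP {A : Language Bool} (hA : A ∈ BQP) : PRel (Oracle.ofLanguage A) ⊆ BQP :=
  fun _ hL => rp_PRel_subset_BQP hA (mem_rp_PRel_of_mem hL)

/-- **`RP^{BQP} ⊆ BQP`**: `rp (PRelClass BQP) ⊆ BQP`. [cite: BennettBernsteinBrassardVazirani1997, Thm. 4.14 and Cor. 4.15] -/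
theorem rp_PRelClass_BQP_subset_BQP : rp (PRelClass BQP) ⊆ BQP := by
  rintro L ⟨L', hL', p, hp⟩
  obtain ⟨A, hA, hL'A⟩ := mem_PRelClass_iff.1 hL'
  exact rp_PRel_subset_BQP hA ⟨L', hL'A, p, hp⟩

/-- **`P^{BQP} ⊆ BQP`.** [cite: BennettBernsteinBrassardVazirani1997, Cor. 4.15] -/
theorem PRelClass_BQP_subset_BQP : PRelClass BQP ⊆ BQP := by
  intro L hL
  obtain ⟨A, hA, hLA⟩ := mem_PRelClass_iff.1 hL
  exact PRel_subset_BQP_of_mem_BQP hA hLA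

end RPRelBQP

end Literature.Computability.QuantumComplexity
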